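/-
Copyright (c) 2026 the pub-hodgecm-mathlib formalisation cell (harness21).  Prover seat hodgecm-mathlib-F0P3-p01 (g30): unit U1_Frames of the «(D-RAM) FOUR-FRAME» road,
TIER-2 file paying the stub `stub_U1_fourFrameData` of `Cruxes/H413/Lines/F0_P3c_DyRamFourFrame_U1_Frames.lean` BY NAME (brick 3 of 3).  2026-09-03.
-/
import Literature.NumberTheory.Automorphic.UnitaryThreeFourFrameFamilyExists                       -- ★ p854761 (this seat): `exists_isFourFrameFamily` (brick 1)
import Literature.NumberTheory.Automorphic.UnitaryThreeFourFrameLiteralUnitary                      -- ★ p854809 (this seat): `exists_frameGL`, `exists_unitary_coe_eq_smul_frameElt` (brick 2)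
import Literature.NumberTheory.Rogawski1990.DepthZeroKappaTransferTypeOneRamifiedSockets            -- ★ `ne_finGammaTwo_of_isUnit_eval_of_eigenframe`; brings ★ `exists_eigenframe_cmDatum_local_of_isRoot_map_of_separable`, `forall_conjLocal_mul_eq_one_of_not_exists_conj_glDiagonal`, `injective_and_norm_one_onePlace_of_localRing`, `isUnit_eval_finCharpolyTwo_of_isLocalGRegular`, `isRegularElt_fst_snd_of_isLocalGRegular`
import Literature.NumberTheory.Rogawski1990.DepthZeroKappaTransferTypeTwoGSide                     -- ★ `setOf_entrywise_deep_mem_nhds_one` (the deep neighbourhood of `1 ∈ H_v`)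
import Literature.NumberTheory.Rogawski1990.LeviNearOneTwoDeep                                      -- ★ `valued_sub_one_le_of_isRoot_charpoly_of_congr_one` (eigenvalues of a deep matrix are deep)
import Literature.NumberTheory.Rogawski1990.FinExplicitTransferFactorResiduallyRegular              -- ★ `charpoly_map_endoEmbLocal_apply` (`χ_{ι(γ_H)_w} = χ_{g_w}·(X − u_w)`)
import Literature.NumberTheory.LocalFields.CompleteValuedSquareRootNearOne                          -- ★ `exists_mul_self_eq_of_valued_sub_one_lt_four_adicCompletion` (canonical dyadic square roots)
import Summits.HodgeConjecture.HodgeConjecture.Theorems.F0P3cDyRamNormOneSqDepthParity              -- ★ p854642 (B-p04): `normOneSq_depth_parity` (`|a² − 1| = |ϖ|^n ⇒ n ≡ d (2)`)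
import Literature.NumberTheory.Automorphic.LocalUnitaryIntegralLevel                                -- ★ `placeForm_antidiagOne`
import HarnessLib

/-!
# Crux `H413`, line LH4 «(D-RAM) FOUR-FRAME» road — unit U1_Frames, TIER 2: THE FOUR-FRAME DATA OF A TYPE-(1) ELEMENT NEAR `1`
# (pays `U1_Frames.stub_U1_fourFrameData` BY NAME — the G-side ∃-half of (D-CΔ) `FourFrameTransferFactor`)

Cell `hodgecm-mathlib` (D-0151), FLOOR 0, crux item H413 = `stmt-HodgeConjecture-24833`, route of record `HCCMUnconditional`; squad F0∕P3c∕LH4; tier-1 socket module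
`Cruxes/H413/Lines/F0_P3c_DyRamFourFrame_U1_Frames.lean` (assembler B-p04), stub U1-3 `stub_U1_fourFrameData (N₀)` (B-p04 (g61) 21:03Z: «U1-3 FREE — F0P3-p01»).
THEOREMS ONLY (no `def`, no instance, no notation, no `sorry`); lane `--supports stmt-HodgeConjecture-24833 --as helper` (count-neutral).

WHAT IS PROVED.  `fourFrameData (N₀) : ‹the statement of stub_U1_fourFrameData N₀ TOKEN FOR TOKEN›`: at a wild ramified non-split place `w ∣ v` with datum
`IsRamifiedQuadraticDatum σ_w ϖ d t_E`, there is a neighbourhood `V` of `1 ∈ H_v` such that every `G`-regular TYPE-(1) (`χ_{g_w}` has a root in `L_w`) NON-LEVI `γ_H = (g, u) ∈ V`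
carries four-frame data: a four-frame family `f`, canonical norm-one square roots `a, b` (`|a − 1|, |b − 1| < |2|`), the norm-one scalar `z = u_w = finGammaTwo` with `z·a², z·b²`
the roots of `χ_{g_w}`, an element datum `(n₁, n₂, n₃)` at threshold `N₀ d`, `k` with `2k + d = n₁ + n₂ + n₃ + 2`, the GL literals `Γ_b = frameElt σ_w f b (a²) (b²)` and group
literals `t_b ∈ U(Φ₃)(L⁺_v)` with one-place matrix `z·Γ_b`.

THE PROOF ([Rogawski1990, §3.6 pp. 31–32, §4.9 pp. 54–55]; [Kottwitz1986, §3]).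
* `V := {γ_H | g_w ≡ 1, u_w ≡ 1 (mod ϖ^m) entrywise}`, `m := N₀ d + 2t_E + 1 + d` (★ `setOf_entrywise_deep_mem_nhds_one`).
* FRAMES: ★ `exists_isFourFrameFamily` (brick 1).
* EIGEN-DATA: the semilocal eigenframe `g·P₂ = P₂·diag(u₀, u₁)` of the split separable `χ_g` (★ `exists_eigenframe_cmDatum_local_of_isRoot_map_of_separable`, separability = `G`-regularity
  ★ `isRegularElt_fst_snd_of_isLocalGRegular`); NON-LEVI ⇒ `u_i` NORM-ONE (★ `forall_conjLocal_mul_eq_one_of_not_exists_conj_glDiagonal`); `G`-regular ⇒ `u₀ ≠ u_w ≠ u₁`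
  (★ `isUnit_eval_finCharpolyTwo_of_isLocalGRegular`, ★ `ne_finGammaTwo_of_isUnit_eval_of_eigenframe`) ⇒ at `w`: `x₁ = (u₀)_w, z = u_w, x₂ = (u₁)_w` pairwise distinct and norm-one
  (★ `injective_and_norm_one_onePlace_of_localRing`); `χ_{g_w} = (X − x₁)(X − x₂)`.
* DEEPNESS: `ι(γ_H)_w ≡ 1 (mod ϖ^m)` entrywise (★ `coe_endoEmbLocal`, `coe_endoGL_eq`), so its eigenvalues `x₁, x₂, z` are `≡ 1 (mod ϖ^m)` (★ `valued_sub_one_le_of_isRoot_charpoly_of_congr_one`,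
  ★ `charpoly_map_endoEmbLocal_apply`); hence `u_i := x_i ∕ z ≡ 1 (mod ϖ^m)`, `m > 2t_E` ⇒ `|u_i − 1| < |4|`.
* CANONICAL ROOTS: `a² = u₁`, `b² = u₂` with `|a − 1|, |b − 1| < |2|` (★ `exists_mul_self_eq_of_valued_sub_one_lt_four_adicCompletion`); `(aσa)² = N(u₁) = 1` and `|aσa − 1| < |2| = |−1 − 1|`
  force `aσa = 1`.
* ELEMENT DATUM: `n₂ := ord(u₁ − 1)`, `n₁ := ord(u₂ − 1)`, `n₃ := ord(u₁ − u₂)`, all `≥ m ≥ N₀ d`; PARITY `n_i ≡ d (mod 2)` by ★ p854642 `normOneSq_depth_parity` at `a`, `b`, `a∕b`, so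
  `k := (n₁ + n₂ + n₃ + 2 − d)∕2` solves `2k + d = Σ n + 2` (`n_i ≥ m ≥ d`).
* LITERALS: `Γ_b` by ★ `exists_frameGL`; `z·Γ_b ∈ U(σ_w, Φ₃)(L_w) = U(σ_w, (Φ₃)_w)` (★ `exists_unitary_coe_eq_smul_frameElt`, ★ `placeForm_antidiagOne`), `t_b := ι_w⁻¹(z·Γ_b)`
  (★ `localNonsplitEquiv` is onto).

HONEST LABEL.  Count-neutral; the verdict of record for (D-RAM) stays PRINT [LanglandsShelstad1989 Thm. p. 484 ∕ Rogawski1990 Prop. 4.9.1 (a)] ∕ XL; `HC_CM` is proved only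
modulo the 7 printed citations (2 remaining: hLiu418 = `stmt-HodgeConjecture-24832`, h413 = `stmt-HodgeConjecture-24833`) until rung 0 closes.

## References
* [Rogawski1990] J. D. Rogawski, *Automorphic Representations of Unitary Groups in Three Variables*, Ann. of Math. Stud. 123 (1990), §3.6 pp. 28–32, §4.9 pp. 54–55.
* [Kottwitz1986] R. E. Kottwitz, *Base change for unit elements of Hecke algebras*, Compositio Math. 60 (1986), §3.
* [Jacobowitz1962] R. Jacobowitz, *Hermitian forms over local fields*, Amer. J. Math. 84 (1962) 441–465, §4.
* [Serre1979] J.-P. Serre, *Local Fields*, GTM 67 (1979), Ch. II §4 Prop. 7 (Hensel), Ch. V §3.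
-/

noncomputable section

namespace Summit.HodgeConjecture.HodgeConjecture.Cruxes.H413.F0P3cDyRamFourFrameData

open MeasureTheory Measure NumberField IsDedekindDomain Topology Filter Polynomial
open Literature.NumberTheory.Automorphic Literature.NumberTheory.Automorphic.UnitaryGroup Literature.NumberTheory.Automorphic.IntegralReduction
open Literature.NumberTheory.Automorphic.UnitaryLatticeTree Literature.NumberTheory.Automorphic.HermitianLattice
open Literature.NumberTheory.Rogawski1990 Literature.NumberTheory.GaloisRepresentations
open Literature.NumberTheory.Automorphic.UnitaryThreeFourFrame
open Summit.HodgeConjecture.HodgeConjecture.Cruxes.H413.F0P3cDyRamNormOneSqDepthParity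
open scoped Matrix MatrixGroups Classical ValuativeRel WithZero Valued

/-! ## §1  Valuation bookkeeping in a valued field -/

section Val

variable {K : Type} [Field K] [Valued K ℤᵐ⁰]

/-- `|y| ≤ |ϖ|^m`, `y ≠ 0`, `|ϖ| = exp(−1)` ⇒ `|y| = |ϖ|^n` for some `n ≥ m`. [cite: Serre1979, Ch. II §1] -/
theorem exists_pow_eq_of_v_le_pow {ϖ : K} (hϖ : Valued.v ϖ = WithZero.exp (-1 : ℤ)) {y : K} (hy : y ≠ 0) {m : ℕ} (hle : Valued.v y ≤ Valued.v (ϖ ^ m)) :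
    ∃ n : ℕ, Valued.v y = Valued.v ϖ ^ n ∧ m ≤ n := by
  rw [map_pow] at hle
  have hvy : Valued.v y ≠ 0 := (Valuation.ne_zero_iff _).2 hy
  obtain ⟨k, hk⟩ : ∃ k : ℤ, Valued.v y = WithZero.exp k := ⟨_, (WithZero.exp_log hvy).symm⟩
  have hkm : k ≤ -(m : ℤ) := by
    rw [hk, hϖ, ← WithZero.exp_nsmul, nsmul_eq_mul, mul_neg, mul_one, WithZero.exp_le_exp] at hle
    exact hle
  refine ⟨(-k).toNat, ?_, by omega⟩
  rw [hk, hϖ, ← WithZero.exp_nsmul, nsmul_eq_mul, mul_neg, mul_one]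
  congr 1
  omega

/-- A square root of a norm-one element is norm-one when it is closer to `1` than `−1` is: `a·a = u`, `u·σu = 1`, `|a − 1| < |2|`, `σ` isometric ⇒ `a·σa = 1`.
[cite: Serre1979, Ch. V §3] [cite: Rogawski1990, §4.9 p. 55] -/
theorem mul_map_eq_one_of_mul_self_eq {σ : K →+* K} (hvσ : ∀ x, Valued.v (σ x) = Valued.v x) {a u : K} (hau : a * a = u) (hu : u * σ u = 1)
    (ha1 : Valued.v (a - 1) < Valued.v (2 : K)) : a * σ a = 1 := by
  have hsq : (a * σ a) * (a * σ a) = 1 := by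
    rw [show (a * σ a) * (a * σ a) = (a * a) * σ (a * a) by rw [map_mul]; ring, hau, hu]
  have hva : Valued.v a = 1 := by
    have hvu : Valued.v u = 1 := v_eq_one_of_mul_map_eq_one hvσ hu
    have h : Valued.v a * Valued.v a = 1 := by rw [← map_mul, hau]; exact hvu
    rcases lt_trichotomy (Valued.v a) 1 with hlt | heq | hgt
    · exact absurd h (mul_lt_one_of_nonneg_of_lt_one_left zero_le hlt hlt.le).ne
    · exact heq
    · exact absurd h (lt_of_lt_of_le hgt (le_mul_of_one_le_right' hgt.le)).ne'
  have hlt : Valued.v (a * σ a - 1) < Valued.v (2 : K) := by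
    rw [show a * σ a - 1 = (a - 1) * σ a + σ (a - 1) by rw [map_sub, map_one]; ring]
    refine (Valuation.map_add _ _ _).trans_lt (max_lt ?_ ?_)
    · rw [map_mul, hvσ, hva, mul_one]; exact ha1
    · rw [hvσ]; exact ha1
  rcases mul_eq_zero.1 (show (a * σ a - 1) * (a * σ a + 1) = 0 by
      rw [show (a * σ a - 1) * (a * σ a + 1) = (a * σ a) * (a * σ a) - 1 by ring, hsq, sub_self]) with h | h
  · exact sub_eq_zero.1 h
  · exfalso
    have hneg : a * σ a = -1 := eq_neg_of_add_eq_zero_left h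
    rw [hneg, show (-1 : K) - 1 = -2 by norm_num, Valuation.map_neg] at hlt
    exact lt_irrefl _ hlt

end Val

/-! ## §2  The head: `U1_Frames.stub_U1_fourFrameData` TOKEN FOR TOKEN -/

set_option maxHeartbeats 1600000 in
-- the carriers' types are large terms
/-- **PAYMENT OF `U1_Frames.stub_U1_fourFrameData`** — the four-frame data of a `G`-regular non-Levi type-(1) `γ_H` near `1` at a wild ramified non-split place (the G-side
∃-half of (D-CΔ) `FourFrameTransferFactor`): frames (brick 1), eigen-data and norm-one roots from the non-Levi eigenframe toolkit, canonical dyadic square roots, the element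
datum at threshold `N₀ d` on the deep neighbourhood, the parity datum `k`, and the literals `Γ_b`, `t_b` (brick 2). [cite: Rogawski1990, §3.6 pp. 28–29; §4.9 p. 54]
[cite: Jacobowitz1962, §4] [cite: Kottwitz1986, §3] -/
theorem fourFrameData (N₀ : ℕ → ℕ) :
    ∀ (L : Type) [Field L] [NumberField L] [IsCMField L]
      {v : HeightOneSpectrum (𝓞 ↥(maximalRealSubfield L))} (w : UnitaryGroup.PlacesOver L v)
      (hw : IsCMField.complexConj L • w.1 = w.1) (_he : v.asIdeal.ramificationIdx' w.1.asIdeal ≠ 1)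
      (_h2 : ¬ IsUnit (2 : (ValuativeRel.valuation (w.1.adicCompletion L)).integer))
      (ϖ : (w.1.adicCompletion L)) (_hϖ : Valued.v ϖ = WithZero.exp (-1 : ℤ)) (d tE : ℕ) (_hD : IsRamifiedQuadraticDatum (galAdicCompletionMap (L := L) (IsCMField.complexConj L) hw) ϖ d tE),
      ∃ V ∈ 𝓝 (1 : ((UnitaryGroup.cmDatum L 2 (Matrix.of fun i j : Fin 2 => if i.val + j.val + 1 = 2 then (1 : L) else 0)).Local v × (UnitaryGroup.cmDatum L 1 (Matrix.of fun i j : Fin 1 => if i.val + j.val + 1 = 1 then (1 : L) else 0)).Local v)), ∀ γH ∈ V, IsLocalGRegular L v γH →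
        (∃ x : (w.1.adicCompletion L), (((((γH).1.val : GL (Fin 2) (UnitaryGroup.LocalRing L v)).val.map (Pi.evalRingHom (fun w' : UnitaryGroup.PlacesOver L v => w'.1.adicCompletion L) w))).charpoly).IsRoot x) →
        ¬ (∃ (y : ((UnitaryGroup.cmDatum L 2 (Matrix.of fun i j : Fin 2 => if i.val + j.val + 1 = 2 then (1 : L) else 0)).Local v × (UnitaryGroup.cmDatum L 1 (Matrix.of fun i j : Fin 1 => if i.val + j.val + 1 = 1 then (1 : L) else 0)).Local v)) (d' : Fin 2 → (UnitaryGroup.LocalRing L v)ˣ),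
            glDiagonal 2 (UnitaryGroup.LocalRing L v) d' = ((y * γH * y⁻¹).1.val : GL (Fin 2) (UnitaryGroup.LocalRing L v))) →
        ∃ (f : Fin 4 → Fin 3 → (Fin 3 → (w.1.adicCompletion L))) (_ : IsFourFrameFamily (galAdicCompletionMap (L := L) (IsCMField.complexConj L) hw) f)
          (a b z : (w.1.adicCompletion L)) (_ : a * (galAdicCompletionMap (L := L) (IsCMField.complexConj L) hw) a = 1) (_ : b * (galAdicCompletionMap (L := L) (IsCMField.complexConj L) hw) b = 1) (_ : z * (galAdicCompletionMap (L := L) (IsCMField.complexConj L) hw) z = 1)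
          (_ : z = finGammaTwo L v γH w) (_ : ((((γH).1.val : GL (Fin 2) (UnitaryGroup.LocalRing L v)).val.map (Pi.evalRingHom (fun w' : UnitaryGroup.PlacesOver L v => w'.1.adicCompletion L) w))).charpoly.IsRoot (z * (a * a))) (_ : ((((γH).1.val : GL (Fin 2) (UnitaryGroup.LocalRing L v)).val.map (Pi.evalRingHom (fun w' : UnitaryGroup.PlacesOver L v => w'.1.adicCompletion L) w))).charpoly.IsRoot (z * (b * b)))
          (_ : Valued.v (a - 1) < Valued.v (2 : (w.1.adicCompletion L))) (_ : Valued.v (b - 1) < Valued.v (2 : (w.1.adicCompletion L)))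
          (n₁ n₂ n₃ : ℕ) (_ : IsElementDatum (galAdicCompletionMap (L := L) (IsCMField.complexConj L) hw) ϖ (N₀ d) (a * a) (b * b) n₁ n₂ n₃)
          (k : ℕ) (_ : 2 * k + d = n₁ + n₂ + n₃ + 2)
          (Γ : Fin 4 → GL (Fin 3) (w.1.adicCompletion L)) (_ : ∀ b', (Γ b' : Matrix (Fin 3) (Fin 3) (w.1.adicCompletion L)) = frameElt (galAdicCompletionMap (L := L) (IsCMField.complexConj L) hw) f b' (a * a) (b * b))
          (tb : Fin 4 → ((UnitaryGroup.cmDatum L 3 (Matrix.of fun i j : Fin 3 => if i.val + j.val + 1 = 3 then (1 : L) else 0)).Local v)),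
          ∀ b', ((((localNonsplitEquiv (IsCMField.complexConj L) (Matrix.of fun i j : Fin 3 => if i.val + j.val + 1 = 3 then (1 : L) else 0) (IsCMField.complexConj_ne_one L) w hw (tb b') :
              ↥(unitaryGroupOfForm (galAdicCompletionMap (L := L) (IsCMField.complexConj L) hw) (placeForm (Matrix.of fun i j : Fin 3 => if i.val + j.val + 1 = 3 then (1 : L) else 0) w.1))) : GL (Fin 3) (w.1.adicCompletion L)) : Matrix (Fin 3) (Fin 3) (w.1.adicCompletion L))) = z • (Γ b' : Matrix (Fin 3) (Fin 3) (w.1.adicCompletion L)) := by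
  intro L _ _ _ v w hw _he _h2 ϖ hϖ d tE hD
  -- ### notation and the datum
  have hc1 : IsCMField.complexConj L ≠ 1 := IsCMField.complexConj_ne_one L
  have hσσ : ∀ x, galAdicCompletionMap (L := L) (IsCMField.complexConj L) hw (galAdicCompletionMap (L := L) (IsCMField.complexConj L) hw x) = x := hD.1
  have hvσ : ∀ x, Valued.v (galAdicCompletionMap (L := L) (IsCMField.complexConj L) hw x) = Valued.v x := hD.2.1
  have h1d : 1 ≤ d := hD.2.2.2.2.2.1
  have h2t : Valued.v (2 : w.1.adicCompletion L) = Valued.v ϖ ^ tE := hD.2.2.2.2.2.2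
  have hϖ0 : ϖ ≠ 0 := (Valuation.ne_zero_iff _).1 (by rw [hϖ]; exact WithZero.exp_ne_zero)
  have hϖ1 : Valued.v ϖ < 1 := by rw [hϖ, ← WithZero.exp_zero, WithZero.exp_lt_exp]; omega
  set m : ℕ := N₀ d + 2 * tE + 1 + d with hm_def
  have hc0 : ϖ ^ m ≠ 0 := pow_ne_zero _ hϖ0
  -- ### the deep neighbourhood
  refine ⟨_, setOf_entrywise_deep_mem_nhds_one L v w hc0, fun γH hγ hreg hsplit hlev => ?_⟩
  obtain ⟨hdg, hdu⟩ := hγ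
  set σw := galAdicCompletionMap (L := L) (IsCMField.complexConj L) hw with hσw_def
  set evw : UnitaryGroup.LocalRing L v →+* w.1.adicCompletion L := Pi.evalRingHom (fun w' : UnitaryGroup.PlacesOver L v => w'.1.adicCompletion L) w with hevw_def
  set gw : Matrix (Fin 2) (Fin 2) (w.1.adicCompletion L) := ((γH.1.val : GL (Fin 2) (UnitaryGroup.LocalRing L v)).val.map evw) with hgw_def
  set z : w.1.adicCompletion L := finGammaTwo L v γH w with hz_def
  -- ### frames (brick 1)
  obtain ⟨f, hf⟩ := exists_isFourFrameFamily L w hw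
  -- ### eigen-data of the split separable `χ_g`
  obtain ⟨x, hx⟩ := hsplit
  have hx' : ((((γH.1.val : GL (Fin 2) (UnitaryGroup.LocalRing L v)).val).charpoly).map evw).IsRoot x := by
    rw [← Matrix.charpoly_map]; exact hx
  have hsep := (isRegularElt_fst_snd_of_isLocalGRegular L v γH hreg).1
  obtain ⟨P₂, u, hP₂, hu, -⟩ := exists_eigenframe_cmDatum_local_of_isRoot_map_of_separable L v w hw γH.1 hx' hsep
  have hu1 : ∀ i, UnitaryGroup.conjLocal L (IsCMField.complexConj L) v (u i) * u i = 1 :=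
    forall_conjLocal_mul_eq_one_of_not_exists_conj_glDiagonal L v w hw hP₂ hu hlev
  have hunit : IsUnit ((finCharpolyTwo L v γH).eval (finGammaTwo L v γH)) := isUnit_eval_finCharpolyTwo_of_isLocalGRegular L v γH hreg
  obtain ⟨hab, hbd⟩ := ne_finGammaTwo_of_isUnit_eval_of_eigenframe L v γH hunit hP₂
  obtain ⟨hxinj, hx1⟩ := injective_and_norm_one_onePlace_of_localRing L v γH w hw hu hu1 hab hbd
  set x₁ : w.1.adicCompletion L := u 0 w with hx₁_def
  set x₂ : w.1.adicCompletion L := u 1 w with hx₂_def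
  -- norm-one and pairwise distinct
  have hσx₁ : σw x₁ * x₁ = 1 := hx1 0
  have hσz : σw z * z = 1 := hx1 1
  have hσx₂ : σw x₂ * x₂ = 1 := hx1 2
  have h1z : x₁ ≠ z := fun h => absurd (hxinj (show (![x₁, z, x₂] : Fin 3 → w.1.adicCompletion L) 0 = (![x₁, z, x₂] : Fin 3 → w.1.adicCompletion L) 1 from h)) (by decide)
  have hz2 : z ≠ x₂ := fun h => absurd (hxinj (show (![x₁, z, x₂] : Fin 3 → w.1.adicCompletion L) 1 = (![x₁, z, x₂] : Fin 3 → w.1.adicCompletion L) 2 from h)) (by decide)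
  have h12 : x₁ ≠ x₂ := fun h => absurd (hxinj (show (![x₁, z, x₂] : Fin 3 → w.1.adicCompletion L) 0 = (![x₁, z, x₂] : Fin 3 → w.1.adicCompletion L) 2 from h)) (by decide)
  have hz0 : z ≠ 0 := fun h => by rw [h, mul_zero] at hσz; exact zero_ne_one hσz
  have hvz : Valued.v z = 1 := v_eq_one_of_mul_map_eq_one hvσ (by rw [mul_comm]; exact hσz)
  -- the characteristic polynomial of `g_w` is `(X − x₁)(X − x₂)`
  have hchar : ((γH.1.val : GL (Fin 2) (UnitaryGroup.LocalRing L v)).val).charpoly = ∏ i : Fin 2, (X - C (u i)) := by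
    have hconj : (P₂⁻¹).val * (γH.1.val : GL (Fin 2) (UnitaryGroup.LocalRing L v)).val * P₂.val = Matrix.diagonal u := by
      rw [Matrix.mul_assoc, hP₂, ← Matrix.mul_assoc, Units.inv_mul, Matrix.one_mul]
    rw [← Matrix.charpoly_units_conj' P₂, ← Matrix.coe_units_inv, hconj, Matrix.charpoly_diagonal]
  have hcharw : gw.charpoly = (X - C x₁) * (X - C x₂) := by
    rw [hgw_def, Matrix.charpoly_map, hchar, Polynomial.map_prod, Fin.prod_univ_two]
    simp only [Polynomial.map_sub, Polynomial.map_X, Polynomial.map_C]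
    rfl
  have hroot₁ : gw.charpoly.IsRoot x₁ := by rw [hcharw, IsRoot, eval_mul, eval_sub, eval_X, eval_C, sub_self, zero_mul]
  have hroot₂ : gw.charpoly.IsRoot x₂ := by rw [hcharw, IsRoot, eval_mul, eval_sub, eval_sub, eval_X, eval_C, eval_C, sub_self, mul_zero]
  -- ### deepness of the eigenvalues
  set ιw : Matrix (Fin 3) (Fin 3) (w.1.adicCompletion L) := ((((endoEmbLocal L v γH).val : GL (Fin 3) (UnitaryGroup.LocalRing L v)).val).map evw) with hιw_def
  have hι : ιw = !![gw 0 0, 0, gw 0 1; 0, z, 0; gw 1 0, 0, gw 1 1] := by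
    rw [hιw_def, coe_endoEmbLocal, coe_endoGL_eq]
    ext a b; fin_cases a <;> fin_cases b <;> simp [gw, z, finGammaTwo, evw]
  have hdeepι : ∀ i j, Valued.v (ιw i j - (1 : Matrix (Fin 3) (Fin 3) (w.1.adicCompletion L)) i j) ≤ Valued.v (ϖ ^ m) := by
    intro i j
    rw [hι]
    have hg := fun i j => hdg i j
    simp only [Matrix.sub_apply] at hg
    fin_cases i <;> fin_cases j
    · simpa [Matrix.one_apply] using hg 0 0
    · simp
    · simpa [Matrix.one_apply] using hg 0 1
    · simp
    · simpa [Matrix.one_apply] using hdu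
    · simp
    · simpa [Matrix.one_apply] using hg 1 0
    · simp
    · simpa [Matrix.one_apply] using hg 1 1
  have hfac : ιw.charpoly = gw.charpoly * (X - C z) := charpoly_map_endoEmbLocal_apply L w
  have hdeep_root : ∀ y, gw.charpoly.IsRoot y → Valued.v (y - 1) ≤ Valued.v (ϖ ^ m) := fun y hy =>
    valued_sub_one_le_of_isRoot_charpoly_of_congr_one ιw hc0 hdeepι (by rw [hfac, IsRoot, eval_mul, hy.eq_zero, zero_mul])
  have hdx₁ : Valued.v (x₁ - 1) ≤ Valued.v (ϖ ^ m) := hdeep_root x₁ hroot₁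
  have hdx₂ : Valued.v (x₂ - 1) ≤ Valued.v (ϖ ^ m) := hdeep_root x₂ hroot₂
  have hdz : Valued.v (z - 1) ≤ Valued.v (ϖ ^ m) := hdu
  -- ### the norm-one ratios `u_i = x_i / z`
  set u₁ : w.1.adicCompletion L := x₁ * z⁻¹ with hu₁_def
  set u₂ : w.1.adicCompletion L := x₂ * z⁻¹ with hu₂_def
  have hzu₁ : z * u₁ = x₁ := by rw [hu₁_def, mul_left_comm, mul_inv_cancel₀ hz0, mul_one]
  have hzu₂ : z * u₂ = x₂ := by rw [hu₂_def, mul_left_comm, mul_inv_cancel₀ hz0, mul_one]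
  have hnorm_ratio : ∀ {y : w.1.adicCompletion L}, σw y * y = 1 → (y * z⁻¹) * σw (y * z⁻¹) = 1 := fun {y} hy => by
    have hσz0 : σw z ≠ 0 := (map_ne_zero σw).2 hz0
    rw [map_mul, map_inv₀, show y * z⁻¹ * (σw y * (σw z)⁻¹) = (σw y * y) * ((σw z)⁻¹ * z⁻¹) by ring, hy, one_mul, ← mul_inv, hσz, inv_one]
  have hu₁1 : u₁ * σw u₁ = 1 := hnorm_ratio hσx₁
  have hu₂1 : u₂ * σw u₂ = 1 := hnorm_ratio hσx₂
  have hu₁ne : u₁ ≠ 1 := fun h => h1z (by rw [← hzu₁, h, mul_one])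
  have hu₂ne : u₂ ≠ 1 := fun h => hz2 (by rw [← hzu₂, h, mul_one])
  have hu₁₂ : u₁ ≠ u₂ := fun h => h12 (by rw [← hzu₁, h, hzu₂])
  have hdepth_ratio : ∀ {y : w.1.adicCompletion L}, Valued.v (y - 1) ≤ Valued.v (ϖ ^ m) → Valued.v (y * z⁻¹ - 1) ≤ Valued.v (ϖ ^ m) := fun {y} hy => by
    have e : y * z⁻¹ - 1 = ((y - 1) - (z - 1)) * z⁻¹ := by rw [sub_sub_sub_cancel_right, sub_mul, mul_inv_cancel₀ hz0]
    rw [e, map_mul, map_inv₀, hvz, inv_one, mul_one]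
    exact (Valuation.map_sub _ _ _).trans (max_le hy hdz)
  have hdu₁ : Valued.v (u₁ - 1) ≤ Valued.v (ϖ ^ m) := hdepth_ratio hdx₁
  have hdu₂ : Valued.v (u₂ - 1) ≤ Valued.v (ϖ ^ m) := hdepth_ratio hdx₂
  have hdu₁₂ : Valued.v (u₁ - u₂) ≤ Valued.v (ϖ ^ m) := by
    rw [show u₁ - u₂ = (u₁ - 1) - (u₂ - 1) by ring]
    exact (Valuation.map_sub _ _ _).trans (max_le hdu₁ hdu₂)
  -- ### canonical square roots
  have h4 : Valued.v (ϖ ^ m) < Valued.v (4 : w.1.adicCompletion L) := by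
    rw [show (4 : w.1.adicCompletion L) = 2 * 2 by norm_num, map_mul, h2t, ← pow_add, map_pow]
    exact pow_lt_pow_right_of_lt_one₀ ((Valuation.pos_iff _).2 hϖ0) hϖ1 (by omega)
  obtain ⟨a, haa, ha1⟩ := Literature.NumberTheory.LocalFields.exists_mul_self_eq_of_valued_sub_one_lt_four_adicCompletion L w.1 u₁ (hdu₁.trans_lt h4)
  obtain ⟨b, hbb, hb1⟩ := Literature.NumberTheory.LocalFields.exists_mul_self_eq_of_valued_sub_one_lt_four_adicCompletion L w.1 u₂ (hdu₂.trans_lt h4)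
  have haσ : a * σw a = 1 := mul_map_eq_one_of_mul_self_eq hvσ haa hu₁1 ha1
  have hbσ : b * σw b = 1 := mul_map_eq_one_of_mul_self_eq hvσ hbb hu₂1 hb1
  have hzσ : z * σw z = 1 := by rw [mul_comm]; exact hσz
  -- ### the element datum
  obtain ⟨n₂, hn₂, hmn₂⟩ := exists_pow_eq_of_v_le_pow hϖ (sub_ne_zero.2 hu₁ne) hdu₁
  obtain ⟨n₁, hn₁, hmn₁⟩ := exists_pow_eq_of_v_le_pow hϖ (sub_ne_zero.2 hu₂ne) hdu₂
  obtain ⟨n₃, hn₃, hmn₃⟩ := exists_pow_eq_of_v_le_pow hϖ (sub_ne_zero.2 hu₁₂) hdu₁₂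
  have hE : IsElementDatum σw ϖ (N₀ d) (a * a) (b * b) n₁ n₂ n₃ := by
    rw [haa, hbb]
    exact ⟨hu₁1, hu₂1, hu₁₂, hu₁ne, hu₂ne, hn₁, hn₂, hn₃, by omega, by omega, by omega⟩
  -- ### parity and `k`
  have hD' : IsRamifiedQuadraticDatum σw ϖ d tE := hD
  have hpar₂ : n₂ % 2 = d % 2 := normOneSq_depth_parity σw ϖ d tE hD' a haσ (by rw [haa]; exact hu₁ne) n₂ (by rw [haa]; exact hn₂)
  have hpar₁ : n₁ % 2 = d % 2 := normOneSq_depth_parity σw ϖ d tE hD' b hbσ (by rw [hbb]; exact hu₂ne) n₁ (by rw [hbb]; exact hn₁)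
  have hb0 : b ≠ 0 := fun h => by rw [h, zero_mul] at hbσ; exact zero_ne_one hbσ
  have hu₂0 : u₂ ≠ 0 := fun h => by rw [h, zero_mul] at hu₂1; exact zero_ne_one hu₂1
  have hvu₂ : Valued.v u₂ = 1 := v_eq_one_of_mul_map_eq_one hvσ hu₂1
  have hpar₃ : n₃ % 2 = d % 2 := by
    refine normOneSq_depth_parity σw ϖ d tE hD' (a / b) ?_ ?_ n₃ ?_
    · rw [map_div₀, div_mul_div_comm, haσ, hbσ, div_one]
    · rw [div_mul_div_comm, haa, hbb]
      intro h
      exact hu₁₂ ((div_eq_one_iff_eq hu₂0).1 h)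
    · rw [div_mul_div_comm, haa, hbb, ← hn₃, div_sub_one hu₂0, map_div₀, hvu₂, div_one]
  -- ### the literals (brick 2)
  have hu₁0 : u₁ ≠ 0 := fun h => by rw [h, zero_mul] at hu₁1; exact zero_ne_one hu₁1
  have hΓex : ∀ b' : Fin 4, ∃ Γ : GL (Fin 3) (w.1.adicCompletion L), (Γ : Matrix (Fin 3) (Fin 3) (w.1.adicCompletion L)) = frameElt σw f b' (a * a) (b * b) := fun b' => by
    rw [haa, hbb]; exact exists_frameGL hf b' hu₁0 hu₂0
  choose Γ hΓ using hΓex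
  have hσu₁ : σw (a * a) * (a * a) = 1 := by rw [haa, mul_comm]; exact hu₁1
  have hσu₂ : σw (b * b) * (b * b) = 1 := by rw [hbb, mul_comm]; exact hu₂1
  have htex : ∀ b' : Fin 4, ∃ t : ((UnitaryGroup.cmDatum L 3 (Matrix.of fun i j : Fin 3 => if i.val + j.val + 1 = 3 then (1 : L) else 0)).Local v),
      ((((localNonsplitEquiv (IsCMField.complexConj L) (Matrix.of fun i j : Fin 3 => if i.val + j.val + 1 = 3 then (1 : L) else 0) (IsCMField.complexConj_ne_one L) w hw t :
        ↥(unitaryGroupOfForm (galAdicCompletionMap (L := L) (IsCMField.complexConj L) hw) (placeForm (Matrix.of fun i j : Fin 3 => if i.val + j.val + 1 = 3 then (1 : L) else 0) w.1))) :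
          GL (Fin 3) (w.1.adicCompletion L)) : Matrix (Fin 3) (Fin 3) (w.1.adicCompletion L))) = z • (Γ b' : Matrix (Fin 3) (Fin 3) (w.1.adicCompletion L)) := by
    intro b'
    obtain ⟨U, hUmem, hU⟩ := exists_unitary_coe_eq_smul_frameElt hf b' hσu₁ hσu₂ hσz
    have hUmem' : U ∈ unitaryGroupOfForm σw (placeForm (Matrix.of fun i j : Fin 3 => if i.val + j.val + 1 = 3 then (1 : L) else 0) w.1) := by
      rw [placeForm_antidiagOne]; exact hUmem
    refine ⟨(localNonsplitEquiv (IsCMField.complexConj L) (Matrix.of fun i j : Fin 3 => if i.val + j.val + 1 = 3 then (1 : L) else 0)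
      (IsCMField.complexConj_ne_one L) w hw).symm ⟨U, hUmem'⟩, ?_⟩
    rw [ContinuousMulEquiv.apply_symm_apply, hΓ b', ← hU]
  choose tb htb using htex
  -- ### assembly
  refine ⟨f, hf, a, b, z, haσ, hbσ, hzσ, rfl, ?_, ?_, ha1, hb1, n₁, n₂, n₃, hE, (n₁ + n₂ + n₃ + 2 - d) / 2, by omega, Γ, hΓ, tb, htb⟩
  · rw [haa, hzu₁]; exact hroot₁
  · rw [hbb, hzu₂]; exact hroot₂

end Summit.HodgeConjecture.HodgeConjecture.Cruxes.H413.F0P3cDyRamFourFrameData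

end
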